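import Summits.ResolutionOfSingularities.ResolutionOfSingularities.Theorems.WeightedInvariantDatumToEmbeddedInvDrop
import Summits.ResolutionOfSingularities.ResolutionOfSingularities.Theorems.WeightedInvariantDatumToEmbeddedExceptional
import Summits.ResolutionOfSingularities.ResolutionOfSingularities.Theorems.WeightedInvariantWeightedConstructionCobordantPlusBaseChange
import Summits.ResolutionOfSingularities.ResolutionOfSingularities.Theorems.WeightedInvariantWeightedConstructionExtReesBaseChange
import Summits.ResolutionOfSingularities.ResolutionOfSingularities.Theorems.WeightedInvariantWeightedConstructionCobordantPlusBasicOpen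
import Summits.ResolutionOfSingularities.ResolutionOfSingularities.Theorems.WeightedInvariantWeightedConstructionStrictTransformLocalization
import Literature.AlgebraicGeometry.Resolution.BlowupRestrictOpen
import HarnessLib

/-!
# e-ladder `e = 1` of the door `HypersurfaceCentreConstruction`: transport of a CHARTWISE order drop (on an open `V ∋ η`) to the
# global cobordant blow-up (piece (L4′) «drop transport»)

Topic: `Summits/ResolutionOfSingularities/ResolutionOfSingularities/Theorems`. Helper for the door item
`HypersurfaceCentreConstruction` (statement `stmt-ResolutionOfSingularities-19897`, route `WeightedInvariant`), line
`local-engine`, RUNG `e = 1`, stub `stub_e1_centre` of res-D-pv-025 AS res-L1-w43-stub-10 (NAMING of res-type-070 for (L4′),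
HOME/STATUS 2026-08-27T08:22:30Z (5)).  res-type-070.  No definitions, proofs only.

[OURS · L1 W4.3] Replaces the role of NO printed item; NOT a statement of the manuscript
[claim: Hironaka2017, status: under-review]. AI work, weaker than expert review.

## Content

`stub_e1_centre` must deliver, for the global centre `P : ReesAlgebraData Y` and EVERY Rees filtration `R'` with the pieces of
`P`, the drop `idealOrder (R'.strictTransformPlus X) b < idealOrder X η` at every point `b` of the GLOBAL cobordant blow-up
`B₊ = R'.plus` over a maximal singular point `η`; the vendored fact (Abramovich–Quek–Schober 2025, clause (3) of
`AbramovichQuekSchober2025_heightTwoCentre`) gives the drop CHARTWISE, on the datum-style affine object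
`B₊(U) = R.cobordantPlus U` of a Rees algebra `R` on an OPEN `V ∋ η` with `R.cobordantStrictTransform U (X|_V)`.  Y-chart half
= the `idealOrder` analogue of `DatumToEmbedded.InvDrop.stub_inv_drop`, whose chart plumbing it reuses by name; V-chart half =
the tree's flat base change of affine cobordant blow-ups, specialised to the base ring ISOMORPHISM `V.ι.appIso U`:

* `idealOrder_strictTransformPlus_eq_chart` — for the chart `φ_U : B₊(U) ⟶ B₊` of `InvDrop.exists_fac` (an open immersion
  over `B₊(U) → U ⊆ Y` pulling `σˢ(X)|_{B₊}` back to the chart's strict transform), `idealOrder (R'.strictTransformPlus X) (φ b)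
  = idealOrder (P.cobordantStrictTransform U X) b` (`idealOrder_comap_of_isOpenImmersion`);
* `idealOrder_strictTransformPlus_lt_of_chart` — a chartwise bound `∀ b : B₊(U), P.cobordantPlusι U b = η → idealOrder … b < c`
  gives the global bound at every `b' : B₊` with `R'.πPlus b' = η`, `η ∈ U` (every such `b'` is `φ_U b`:
  `DatumToEmbedded.Exceptional.exists_mem_plusChart` + `InvDrop.exists_apply_eq_of_fac`);
* `idealOrder_strictTransformPlus_lt_of_chart_of_isRegularWeightedCentre` — the same with `B` locally Noetherian derived from
  `P.IsRegularWeightedCentre` on a locally Noetherian `Y` (`WeightedThesis.GlobalCobordantPlus.locallyOfFiniteType_π`);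
* `exists_iso_plus_of_ringEquiv` — along a base ring isomorphism `e : A ≃+* A'` with `I' = e(I)`, the datum-style cobordant
  blow-ups are ISOMORPHIC over `Spec e`, with matching strict transforms (`stub_extReesAlgebra_baseChange` for the flat algebra `e`
  + `CobordantPlusBaseChange.exists_plus_baseChange` + `IsPullback.isIso_fst_of_isIso`);
* **`idealOrder_strictTransformPlus_lt_of_local`** — the (L4′) statement: the chartwise drop of a Rees algebra `R` on an open
  `V ∋ η` (clause (3) of the vendored fact, verbatim) transports to every Rees filtration with the pieces of a regular weighted
  centre `P` on `Y` whose pieces on `V.ι ''ᵁ U` are those of `R` on `U` (along `V.ι.appIso U`, the shape of Mathlib's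
  `Scheme.IdealSheafData.ideal_comap_of_isOpenImmersion`);
* `idealOrder_cobordantStrictTransform_lt_basicOpen`, **`idealOrder_strictTransformPlus_lt_of_local_basicOpen`** — the owner's
  reshaped form (res-D-pv-025 AS stub-10, 2026-08-27T08:59:30Z): the agreement of `P` with `R` is asked only on a basic open
  `D(h) ∋ η` of the vendored chart `U` (the drop restricts along the open immersion `B₊(D(h)) ⟶ B₊(U)` of
  `stub_cobordantPlus_basicOpen_openImmersion` ∘ `stub_strictTransform_localization`).

## References

* J. Włodarczyk, *Functorial resolution by torus actions*, arXiv:2203.03090, Def. 2.3.5, 3.3.12–3.3.13, Def. 5.1.1. [Wlodarczyk2022]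
* D. Abramovich, M. H. Quek, B. Schober, arXiv:2507.01232, Thm 1.3 (3). [AbramovichQuekSchober2025]
-/

noncomputable section

open scoped LaurentPolynomial
open CategoryTheory AlgebraicGeometry TopologicalSpace
open Literature.AlgebraicGeometry.Resolution
open Summit.ResolutionOfSingularities.ResolutionOfSingularities.Theorems
open Summit.ResolutionOfSingularities.ResolutionOfSingularities.Theorems.DatumToEmbedded

set_option linter.dupNamespace false -- mandated namespace of this single-conjunct summit
-- `Γ(Y, U)` versus `Y.presheaf.obj (op U)` inside `rw` motives and instance problems (as in `…InvDrop`):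
set_option backward.isDefEq.respectTransparency false

namespace Summit.ResolutionOfSingularities.ResolutionOfSingularities.Theorems.ELadderOne.DropTransport

variable {Y : Scheme.{0}} (P : ReesAlgebraData Y) (R' : ReesFiltration Y) (hR' : R'.ideal = P.piece)

include hR' in
/-- The pieces of `R'` over an affine `U` are the chart ideals of `P`. [folklore] -/
theorem filtration_ideal_eq_chartIdeals (U : Y.affineOpens) : (R'.filtration U).ideal = P.chartIdeals U :=
  funext fun n => by rw [ReesFiltration.filtration_ideal, hR']; rfl

/-- **The order of the global strict transform at a point of the chart `φ_U : B₊(U) ⟶ B₊` is the order of the chart's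
strict transform** (`φ_U` an open immersion pulling `σˢ(X)|_{B₊}` back to `P.cobordantStrictTransform U X`).
[cite: Wlodarczyk2022, 3.3.13] -/
theorem idealOrder_strictTransformPlus_eq_chart [IsLocallyNoetherian R'.cobordantBlowup] (U : Y.affineOpens)
    (θ : (R'.filtration U).extendedRees ≃+* extReesAlgebra (P.chartIdeals U))
    (hθ : ∀ x, ((θ x : extReesAlgebra (P.chartIdeals U)) : (Γ(Y, U))[T;T⁻¹]) = x)
    (φ : affineCobordantBlowup.plus (P.chartIdeals U) ⟶ (R'.plus : Scheme.{0}))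
    (hφ : φ ≫ R'.plus.ι = (affineCobordantBlowup.plusOpens (P.chartIdeals U)).ι ≫
      Spec.map (CommRingCat.ofHom θ.toRingHom) ≫ R'.openCover.f ⟨U.1, U.2⟩)
    (X : Y.IdealSheafData) (b : P.cobordantPlus U) :
    idealOrder (R'.strictTransformPlus X) (φ b) = idealOrder (P.cobordantStrictTransform U X) b := by
  haveI := InvDrop.isOpenImmersion_of_fac R' U _ θ φ hφ
  rw [← idealOrder_comap_of_isOpenImmersion φ (R'.strictTransformPlus X) b,
    InvDrop.comap_strictTransformPlus_of_fac R' U _ θ hθ φ hφ X]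
  rfl

include hR' in
/-- **Chartwise drop ⇒ global drop.**  If the chart's strict transform has order `< c` at every point of
`B₊(U) = P.cobordantPlus U` over `η ∈ U`, then the global strict transform `σˢ(X)|_{B₊}` has order `< c` at every point of
`B₊ = R'.plus` over `η` (every such point is `φ_U b` for the chart over `U`). [cite: Wlodarczyk2022, Def. 5.1.1] -/
theorem idealOrder_strictTransformPlus_lt_of_chart [IsLocallyNoetherian R'.cobordantBlowup] (X : Y.IdealSheafData)
    (U : Y.affineOpens) (η : Y) (hηU : η ∈ (U : Y.Opens)) (c : ℕ∞)
    (hdrop : ∀ b : P.cobordantPlus U, P.cobordantPlusι U b = η → idealOrder (P.cobordantStrictTransform U X) b < c)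
    (b' : ↥R'.plus) (hb' : R'.πPlus b' = η) : idealOrder (R'.strictTransformPlus X) b' < c := by
  have hJ := filtration_ideal_eq_chartIdeals P R' hR' U
  obtain ⟨θ, hθ⟩ := InvDrop.exists_ringEquiv (R'.filtration U) (P.chartIdeals U) hJ
  obtain ⟨φ, hφ⟩ := InvDrop.exists_fac R' U _ θ hθ hJ
  -- `b'` lies in the image of the chart over `U` since `π b' = η ∈ U`
  have hπ : R'.π b'.1 ∈ (U : Y.Opens) := by
    have : R'.π b'.1 = R'.πPlus b' := by
      rw [ReesFiltration.πPlus, Scheme.Hom.comp_apply, Scheme.Opens.ι_apply]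
    rw [this, hb']
    exact hηU
  obtain ⟨q, hq, hqb⟩ := Exceptional.exists_mem_plusChart R' b'.1 b'.2 U hπ
  obtain ⟨b, rfl⟩ := InvDrop.exists_apply_eq_of_fac R' U _ θ hθ φ hφ hJ b' ⟨q, hq, hqb⟩
  rw [idealOrder_strictTransformPlus_eq_chart P R' U θ hθ φ hφ X b]
  refine hdrop b ?_
  have h := congrArg (fun ψ => ψ b) (InvDrop.comp_πPlus_of_fac R' U _ θ hθ φ hφ)
  simp only [Scheme.Hom.comp_apply] at h
  rw [ReesAlgebraData.cobordantPlusι, Scheme.Hom.comp_apply]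
  exact h.symm.trans hb'

include hR' in
/-- The same for a REGULAR WEIGHTED CENTRE `P` on a locally Noetherian `Y` (the global `B` is then locally of finite type over
`Y`, `WeightedThesis.GlobalCobordantPlus.locallyOfFiniteType_π`, hence locally Noetherian). [cite: Wlodarczyk2022, Def. 5.1.1] -/
theorem idealOrder_strictTransformPlus_lt_of_chart_of_isRegularWeightedCentre [IsLocallyNoetherian Y]
    (hP : P.IsRegularWeightedCentre) (X : Y.IdealSheafData) (U : Y.affineOpens) (η : Y) (hηU : η ∈ (U : Y.Opens))
    (c : ℕ∞)
    (hdrop : ∀ b : P.cobordantPlus U, P.cobordantPlusι U b = η → idealOrder (P.cobordantStrictTransform U X) b < c)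
    (b' : ↥R'.plus) (hb' : R'.πPlus b' = η) : idealOrder (R'.strictTransformPlus X) b' < c := by
  haveI : LocallyOfFiniteType R'.π := WeightedThesis.GlobalCobordantPlus.locallyOfFiniteType_π P R' hR' hP
  haveI : IsLocallyNoetherian R'.cobordantBlowup := LocallyOfFiniteType.isLocallyNoetherian R'.π
  exact idealOrder_strictTransformPlus_lt_of_chart P R' hR' X U η hηU c hdrop b' hb'

/-! ## The V-chart half: the vendored fact lives on an open `V ∋ η`; transport along a base ring isomorphism -/

/-- **Cobordant blow-ups of affine charts along a base ring ISOMORPHISM.**  For `e : A ≃+* A'`, filtrations `I` on `A` and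
`I' = e(I)` on `A'`, and an ideal `𝔞 ≤ A`, there is an ISOMORPHISM `j : B₊(A', I') ⟶ B₊(A, I)` of the datum-style cobordant
blow-ups lying over `Spec e : Spec A' ⟶ Spec A` and pulling the strict transform of `V(𝔞)` back to that of `V(e 𝔞)` — the flat
base change of the tree (`stub_extReesAlgebra_baseChange` + `CobordantPlusBaseChange.exists_plus_baseChange`) for the flat algebra
`e`, an isomorphism by `IsPullback.isIso_fst_of_isIso`. [cite: Wlodarczyk2022, Def. 2.3.5] -/
theorem exists_iso_plus_of_ringEquiv {A A' : Type} [CommRing A] [CommRing A'] (e : A ≃+* A') (I : ℕ → Ideal A)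
    (I' : ℕ → Ideal A') (hI : ∀ n, I' n = (I n).map e.toRingHom) (𝔞 : Ideal A) :
    ∃ j : (affineCobordantBlowup.plusOpens I' : Scheme.{0}) ⟶ affineCobordantBlowup.plusOpens I,
      IsIso j ∧
      j ≫ affineCobordantBlowup.plusπ I = affineCobordantBlowup.plusπ I' ≫ Spec.map (CommRingCat.ofHom e.toRingHom) ∧
      (affineCobordantBlowup.strictTransformPlus I 𝔞).comap j =
        affineCobordantBlowup.strictTransformPlus I' (𝔞.map e.toRingHom) := by
  letI : Algebra A A' := e.toRingHom.toAlgebra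
  haveI : Module.Flat A A' := RingHom.Flat.of_bijective e.bijective
  have hI' : ∀ n, I' n = (I n).map (algebraMap A A') := hI
  obtain ⟨ψ, -, hcomp, hs, hvert, hstrict, huniv⟩ := stub_extReesAlgebra_baseChange I I' hI'
  obtain ⟨j, hpb, hst, -⟩ := CobordantPlusBaseChange.exists_plus_baseChange I I' ψ (algebraMap A A') hcomp hs hvert
    (𝔞 := 𝔞) (𝔞' := 𝔞.map e.toRingHom) (hstrict 𝔞) huniv
  haveI : IsIso (Spec.map (CommRingCat.ofHom (algebraMap A A'))) :=
    inferInstanceAs (IsIso (Spec.map e.toCommRingCatIso.hom))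
  exact ⟨j, hpb.isIso_fst_of_isIso, hpb.w, hst⟩

include hR' in
/-- **(L4′) «drop transport».**  Let `X` be an ideal sheaf on a locally Noetherian scheme `Y`, `η ∈ Y`, and let the vendored fact
(clause (3) of `AbramovichQuekSchober2025_heightTwoCentre`) be given on an open `V ∋ η`: a Rees algebra `R` on `V` with an affine chart
`U ∋ η` such that the strict transform of `X|_V` on `B₊(U) = R.cobordantPlus U` has order `< ord_η X` at every point over `η`.  Let
`P` be a regular weighted centre on `Y` whose pieces on the affine open `V.ι ''ᵁ U` of `Y` are those of `R` on `U` (along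
`V.ι.appIso U`; only this one chart is compared — `P` may differ from `R` off `U`).  Then for EVERY Rees filtration `R'` with the
pieces of `P`, the global strict transform `σˢ(X)|_{B₊}` on `B₊ = R'.plus` has order `< ord_η X` at every point over `η`.
Route: `exists_iso_plus_of_ringEquiv` along `V.ι.appIso U` identifies `R.cobordantPlus U ≅ P.cobordantPlus (V.ι ''ᵁ U)` over `V.ι`
(`IsAffineOpen.SpecMap_appLE_fromSpec`) with matching strict transforms (`Scheme.IdealSheafData.ideal_comap_of_isOpenImmersion`),
then `idealOrder_strictTransformPlus_lt_of_chart_of_isRegularWeightedCentre`. [cite: Wlodarczyk2022, Def. 5.1.1]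
[cite: AbramovichQuekSchober2025, Thm 1.3 (3)] -/
theorem idealOrder_strictTransformPlus_lt_of_local [IsLocallyNoetherian Y] (X : Y.IdealSheafData) (η : Y) (V : Y.Opens)
    (hηV : η ∈ V) (R : ReesAlgebraData (V : Scheme.{0})) (U : (V : Scheme.{0}).affineOpens)
    (hηU : (⟨η, hηV⟩ : (V : Scheme.{0})) ∈ (U : (V : Scheme.{0}).Opens))
    (hdrop : ∀ b : R.cobordantPlus U, R.cobordantPlusι U b = ⟨η, hηV⟩ →
      idealOrder (R.cobordantStrictTransform U (X.comap V.ι)) b < idealOrder X η)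
    (hP : P.IsRegularWeightedCentre)
    (hRP : ∀ n, (R.piece n).ideal U =
      ((P.piece n).ideal ⟨V.ι ''ᵁ U, U.2.image_of_isOpenImmersion V.ι⟩).comap (V.ι.appIso U).inv.hom)
    (b : ↥R'.plus) (hb : R'.πPlus b = η) : idealOrder (R'.strictTransformPlus X) b < idealOrder X η := by
  -- the affine open `U' = V.ι '' U` of `Y` and the base ring isomorphism `e : Γ(Y, U') ≅ Γ(V, U)`
  set U' : Y.affineOpens := ⟨V.ι ''ᵁ U, U.2.image_of_isOpenImmersion V.ι⟩
  have hηU' : η ∈ (U' : Y.Opens) := ⟨⟨η, hηV⟩, hηU, rfl⟩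
  let e : Γ(Y, U') ≃+* Γ(V, U) := (V.ι.appIso U).commRingCatIsoToRingEquiv
  have he : e.toRingHom = (V.ι.appIso U).hom.hom := rfl
  have hesymm : ∀ J : Ideal Γ(Y, U'), J.comap (V.ι.appIso U).inv.hom = J.map e.toRingHom := fun J =>
    Ideal.comap_symm (I := J) e
  -- chart ideals and the hypersurface ideal correspond along `e`
  have hI : ∀ n, R.chartIdeals U n = (P.chartIdeals U' n).map e.toRingHom := fun n => by
    rw [ReesAlgebraData.chartIdeals_apply, ReesAlgebraData.chartIdeals_apply, hRP n, hesymm]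
  have hK : (X.comap V.ι).ideal U = (X.ideal U').map e.toRingHom := by
    rw [Scheme.IdealSheafData.ideal_comap_of_isOpenImmersion X V.ι U, hesymm]
  -- the isomorphism of the two affine cobordant blow-ups
  obtain ⟨j, hj, hw, hst⟩ := exists_iso_plus_of_ringEquiv e (P.chartIdeals U') (R.chartIdeals U) hI (X.ideal U')
  haveI := hj
  refine idealOrder_strictTransformPlus_lt_of_chart_of_isRegularWeightedCentre P R' hR' hP X U' η hηU' (idealOrder X η)
    (fun b₁ hb₁ => ?_) b hb
  -- `b₁ = j b₀`
  obtain ⟨b₀, rfl⟩ : ∃ b₀ : R.cobordantPlus U, j b₀ = b₁ :=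
    ⟨inv j b₁, by rw [← Scheme.Hom.comp_apply, IsIso.inv_hom_id]; rfl⟩
  -- orders agree along the isomorphism `j`
  have hord : idealOrder (P.cobordantStrictTransform U' X) (j b₀) =
      idealOrder (R.cobordantStrictTransform U (X.comap V.ι)) b₀ := by
    rw [← idealOrder_comap_of_isOpenImmersion j (P.cobordantStrictTransform U' X) b₀, ReesAlgebraData.cobordantStrictTransform,
      ReesAlgebraData.cobordantStrictTransform, hst, hK]
  rw [hord]
  refine hdrop b₀ (Subtype.ext ?_)
  -- the base points correspond: `V.ι (σ₊ b₀) = σ₊' (j b₀) = η`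
  have hsq : j ≫ P.cobordantPlusι U' = R.cobordantPlusι U ≫ V.ι := by
    rw [ReesAlgebraData.cobordantPlusι, ReesAlgebraData.cobordantPlusι, ← Category.assoc, hw, Category.assoc,
      Category.assoc, he, CommRingCat.ofHom_hom, Scheme.Hom.appIso_hom',
      IsAffineOpen.SpecMap_appLE_fromSpec V.ι U'.2 U.2]
  have h := congrArg (fun ψ => ψ b₀) hsq
  simp only [Scheme.Hom.comp_apply, Scheme.Opens.ι_apply] at h
  exact h.symm.trans hb₁

/-! ## Shrinking the chart: the drop restricts to a basic open `D(h) ∋ η` of the vendored chart `U`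

res-D-pv-025 AS stub-10, RESHAPE 2026-08-27T08:59:30Z (2): the product centre `P` agrees with the vendored Rees algebra `R` only on
an affine open of `U` missing the OTHER orbit closures; basic opens `D(h) ⊆ U` are a basis, and the datum-style cobordant blow-up of
`D(h)` is an open piece of that of `U` (`stub_cobordantPlus_basicOpen_openImmersion`, conditional on the landed ring statement
`stub_strictTransform_localization`), so the chartwise drop restricts. -/

/-- **The chartwise drop restricts to a basic open.**  If the strict transform on `B₊(U) = R.cobordantPlus U` has order `< c` at
every point over `y`, then so does the strict transform on `B₊(D(h))` for every `h ∈ Γ(Y, U)` (open immersion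
`B₊(D(h)) ⟶ B₊(U)` over `Y` matching the strict transforms; `idealOrder_comap_of_isOpenImmersion`). [cite: Wlodarczyk2022, Def. 5.1.1] -/
theorem idealOrder_cobordantStrictTransform_lt_basicOpen {Y : Scheme.{0}} (R : ReesAlgebraData Y) (U : Y.affineOpens)
    (h : Γ(Y, U)) (X : Y.IdealSheafData) (y : Y) (c : ℕ∞)
    (hdrop : ∀ b : R.cobordantPlus U, R.cobordantPlusι U b = y → idealOrder (R.cobordantStrictTransform U X) b < c)
    (b' : R.cobordantPlus (Y.affineBasicOpen h)) (hb' : R.cobordantPlusι (Y.affineBasicOpen h) b' = y) :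
    idealOrder (R.cobordantStrictTransform (Y.affineBasicOpen h) X) b' < c := by
  obtain ⟨j, hj, hjπ, hst, -, -⟩ :=
    stub_cobordantPlus_basicOpen_openImmersion stub_strictTransform_localization R U h X
  haveI := hj
  rw [← hst, idealOrder_comap_of_isOpenImmersion j (R.cobordantStrictTransform U X) b']
  refine hdrop (j b') ?_
  rw [← Scheme.Hom.comp_apply, hjπ]
  exact hb'

include hR' in
/-- **(L4′) «drop transport», the owner's reshaped form** (res-D-pv-025 AS stub-10, 2026-08-27T08:59:30Z (2)): as
`idealOrder_strictTransformPlus_lt_of_local`, but the agreement of the regular weighted centre `P` with the vendored Rees algebra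
`R` is asked only on a BASIC OPEN `D(h) ∋ η` of the vendored affine chart `U` (the product centre differs from `R` near the other
orbit closures, which a small basic open avoids), while the drop hypothesis stays the vendored clause (3) on `R.cobordantPlus U`
verbatim (restricted inside by `idealOrder_cobordantStrictTransform_lt_basicOpen`). [cite: Wlodarczyk2022, Def. 5.1.1]
[cite: AbramovichQuekSchober2025, Thm 1.3 (3)] -/
theorem idealOrder_strictTransformPlus_lt_of_local_basicOpen [IsLocallyNoetherian Y] (X : Y.IdealSheafData) (η : Y)
    (V : Y.Opens) (hηV : η ∈ V) (R : ReesAlgebraData (V : Scheme.{0})) (U : (V : Scheme.{0}).affineOpens)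
    (hdrop : ∀ b : R.cobordantPlus U, R.cobordantPlusι U b = ⟨η, hηV⟩ →
      idealOrder (R.cobordantStrictTransform U (X.comap V.ι)) b < idealOrder X η)
    (h : Γ((V : Scheme.{0}), U)) (hηh : (⟨η, hηV⟩ : (V : Scheme.{0})) ∈ (V : Scheme.{0}).basicOpen h)
    (hP : P.IsRegularWeightedCentre)
    (hRP : ∀ n, (R.piece n).ideal ((V : Scheme.{0}).affineBasicOpen h) =
      ((P.piece n).ideal ⟨V.ι ''ᵁ ((V : Scheme.{0}).affineBasicOpen h : (V : Scheme.{0}).Opens),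
        ((V : Scheme.{0}).affineBasicOpen h).2.image_of_isOpenImmersion V.ι⟩).comap
        (V.ι.appIso ((V : Scheme.{0}).affineBasicOpen h : (V : Scheme.{0}).Opens)).inv.hom)
    (b : ↥R'.plus) (hb : R'.πPlus b = η) : idealOrder (R'.strictTransformPlus X) b < idealOrder X η :=
  idealOrder_strictTransformPlus_lt_of_local P R' hR' X η V hηV R ((V : Scheme.{0}).affineBasicOpen h) hηh
    (idealOrder_cobordantStrictTransform_lt_basicOpen R U h (X.comap V.ι) ⟨η, hηV⟩ (idealOrder X η) hdrop) hP hRP b hb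

end Summit.ResolutionOfSingularities.ResolutionOfSingularities.Theorems.ELadderOne.DropTransport

end
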